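import Mathlib
import Summits.NavierStokesRegularity.NavierStokesRegularity.Theorems.EulerZoomLiouvillePowerGaugeEulerLiouvilleForwardEscapeTools
import Summits.NavierStokesRegularity.NavierStokesRegularity.Theorems.EulerZoomLiouvillePowerGaugeEulerLiouvilleSelfSimilarKelvinFlowC2
import HarnessLib

/-!
# Crux `EulerZoomLiouville.PowerGaugeEulerLiouville` (stmt-NavierStokesRegularity-19832): THE FORWARD ESCAPE LAW — plate t59-ESC of nsreg-p2 ROUND-54 «THE TRACE»

Width/portrait piece (seat ns-ezl-w3 g8, `--supports stmt-NavierStokesRegularity-19832 --as helper`).  Text = nsreg-p2 g44's `NsregP2.R54.Trace.ForwardEscapeLaw ρ V`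
(`r54/Sketch54.lean` sha16 f78682d2f4ee3f27) VERBATIM with `simFlow` unfolded.

For a `C²` self-similar Euler profile `(V, P)` (`γ = 1/(2+ρ)`, `ρ > −2`, centre `0`) with the `A`-gauge, in the cut-off idiom: the labels `y ∈ B_L` whose PHYSICAL radius
`e^{−γs}‖Ψ_s y‖` reaches `C·L` before the horizon `S` have volume `≤ 8A·(CL)^{−(1+2ρ)}` — uniformly in `S` and in the cut-off.

* `Trace.escape_crossing_bound` — **the per-label crossing inequality**: for an escaping label (`‖y‖ < L ≤ CL/2`), with the FIRST EXIT TIME `s₂` (closed set, infimum attained) the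
  trajectory stays in the `CL`-tube on `[0, s₂]`, and the SMOOTH squared physical radius `ρ₂(s) = e^{−2γs}‖Ψ_s y‖²` (`ρ₂′ = 2e^{−2γs}⟪Ψ_s y, V′(Ψ_s y)⟫`, no differentiability of
  `‖·‖` at `0` needed) climbs from `< (CL)²/4` to `≥ (CL)²`, whence `(3/8)CL ≤ ∫₀^{s₂} e^{−γs}‖V′(Ψ_s y)‖ds` and, by Cauchy–Schwarz in time (`e^{−γs} = e^{−s/2}·e^{(½−γ)s}`),
  `(9/64)(CL)² ≤ ∫_{[0,S]} 𝟙_{stay}·e^{(1−2γ)s}‖V′(Ψ_s y)‖² ds`;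
* ★ `Trace.forwardEscapeLaw (hρ : -2 < ρ) (V)` = t59-ESC VERBATIM: Markov over the labels, Tonelli, the velocity slice `Trace.lintegral_velocitySq_slice_le`
  (Jacobian `e^{3γσ}`, closed-ball `A`-gauge), the exponent identity `(1−2γ) − 3γ + γ(1−2ρ) = −1` and `∫₀^S e^{−σ} ≤ 1`: `vol ≤ (64/9)·A·(CL)^{−(1+2ρ)} ≤ 8A(CL)^{−(1+2ρ)}`.

HONEST FRAMING: a portrait instrument about HYPOTHETICAL profiles (label-measure escape bound); nothing about the crux E (19832 OPEN) or NS regularity is proved; not E.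
[nsreg-p2 R54 §C t59-ESC; cite: ConstantinIgnatovaVicol2026Putative, §3.4.1 eq. (3.21)–(3.22)]
-/

noncomputable section

set_option linter.dupNamespace false

open MeasureTheory Set Filter Topology Metric Function
open scoped RealInnerProductSpace NNReal ENNReal ContDiff Topology

namespace Summit.NavierStokesRegularity.NavierStokesRegularity.Theorems.PowerGaugeEulerLiouville.Trace

open Literature.Analysis Literature.Analysis.FluidPDE
open Summit.NavierStokesRegularity.NavierStokesRegularity.Theorems.PowerGaugeEulerLiouville.NeedleFeeding

/-! ### The per-label crossing inequality -/

/-- **The crossing inequality of an escaping label.**  `V′ ∈ C²` with `‖DV′‖ ≤ K`, flow `Ψ` of `W = γy + V′`; `C ≥ 2`, `L > 0`, a label `‖y‖ < L` and a time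
`s ∈ [0, S]` with `CLe^{γs} ≤ ‖Ψ_s y‖`.  Then `(9/64)(CL)² ≤ ∫_{[0,S]} 𝟙_{stay(σ)}·e^{(1−2γ)σ}·‖V′(Ψ_σ y)‖² dσ`
(`stay(σ)`: `‖Ψ_{σ″} y‖ ≤ CLe^{γσ″}` for all `σ″ ∈ [0, σ]`). [nsreg-p2 R54 §C t59-ESC; cite: ConstantinIgnatovaVicol2026Putative, §3.4.1 eq. (3.21)] -/
theorem escape_crossing_bound {ρ : ℝ} (hρ : 2 + ρ ≠ 0) {V' : EuclideanSpace ℝ (Fin 3) → EuclideanSpace ℝ (Fin 3)} (hV' : ContDiff ℝ 2 V')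
    {K : ℝ} (hK : ∀ y, ‖fderiv ℝ V' y‖ ≤ K) {C L S : ℝ} (hC : 2 ≤ C) (hL : 0 < L) (hS : 0 ≤ S)
    {y : EuclideanSpace ℝ (Fin 3)} (hy : ‖y‖ < L)
    (hesc : ∃ s ∈ Icc 0 S, C * L * Real.exp (s / (2 + ρ)) ≤
      ‖ODE.evolutionMap (fun _ : ℝ => selfSimilarTransport (1 / (2 + ρ)) (0 : EuclideanSpace ℝ (Fin 3)) V') 0 s y‖) :
    ENNReal.ofReal (9 / 64 * (C * L) ^ 2) ≤
      ∫⁻ σ in Icc 0 S, indicator {σ' : ℝ | ∀ σ'' ∈ Icc 0 σ',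
          ‖ODE.evolutionMap (fun _ : ℝ => selfSimilarTransport (1 / (2 + ρ)) (0 : EuclideanSpace ℝ (Fin 3)) V') 0 σ'' y‖ ≤
            C * L * Real.exp (σ'' / (2 + ρ))}
        (fun σ' : ℝ => ENNReal.ofReal (Real.exp ((1 - 2 * (1 / (2 + ρ))) * σ')) *
          ‖V' (ODE.evolutionMap (fun _ : ℝ => selfSimilarTransport (1 / (2 + ρ)) (0 : EuclideanSpace ℝ (Fin 3)) V') 0 σ' y)‖ₑ ^ 2) σ := by
  set γ : ℝ := 1 / (2 + ρ) with hγdef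
  have hV1 : ContDiff ℝ 1 V' := hV'.of_le (by norm_num)
  set Φ : ℝ → EuclideanSpace ℝ (Fin 3) := fun s => ODE.evolutionMap (fun _ : ℝ => selfSimilarTransport γ 0 V') 0 s y with hΦdef
  have hΦc : Continuous Φ := C2.Kelvin.continuous_flow_apply (γ := γ) hV1 hK y
  have hΦ0 : Φ 0 = y := ODE.evolutionMap_self _ 0 y
  have hΦd : ∀ s, HasDerivAt Φ (selfSimilarTransport γ 0 V' (Φ s)) s := fun s => C2.Kelvin.hasDerivAt_flow (γ := γ) hV1 hK s y
  have hCL : 0 < C * L := by nlinarith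
  set f : ℝ → ℝ := fun s => C * L * Real.exp (s / (2 + ρ)) with hfdef
  have hfc : Continuous f := by fun_prop
  -- ### the first exit time
  set T : Set ℝ := {s | s ∈ Icc 0 S ∧ f s ≤ ‖Φ s‖} with hTdef
  have hTc : IsClosed T := isClosed_Icc.inter (isClosed_le hfc hΦc.norm)
  have hTne : T.Nonempty := by obtain ⟨s, hs, h⟩ := hesc; exact ⟨s, hs, h⟩
  have hTbdd : BddBelow T := ⟨0, fun s hs => hs.1.1⟩
  set s₂ : ℝ := sInf T with hs₂def
  have hs₂T : s₂ ∈ T := hTc.csInf_mem hTne hTbdd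
  have hs₂0 : 0 ≤ s₂ := hs₂T.1.1
  have hs₂S : s₂ ≤ S := hs₂T.1.2
  have hexit : f s₂ ≤ ‖Φ s₂‖ := hs₂T.2
  -- `s₂ > 0`: at time `0` the label is inside (`‖y‖ < L ≤ CL`)
  have hf0 : f 0 = C * L := by simp [hfdef]
  have hs₂pos : 0 < s₂ := by
    rcases eq_or_lt_of_le hs₂0 with h | h
    · exfalso
      have h1 : f 0 ≤ ‖Φ 0‖ := by rw [h]; exact hexit
      rw [hf0, hΦ0] at h1
      nlinarith [mul_nonneg (sub_nonneg.2 hC) hL.le]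
    · exact h
  -- the trajectory stays in the tube on `[0, s₂]`
  have hbefore : ∀ s ∈ Ico 0 s₂, ‖Φ s‖ < f s := by
    intro s hs
    by_contra hcon
    have hsT : s ∈ T := ⟨⟨hs.1, le_trans hs.2.le hs₂S⟩, not_lt.1 hcon⟩
    exact absurd (csInf_le hTbdd hsT) (not_le.2 hs.2)
  have hstay : ∀ s ∈ Icc 0 s₂, ‖Φ s‖ ≤ f s := by
    have hZ : IsClosed {s : ℝ | ‖Φ s‖ ≤ f s} := isClosed_le hΦc.norm hfc
    have hsub : Ico 0 s₂ ⊆ {s : ℝ | ‖Φ s‖ ≤ f s} := fun s hs => (hbefore s hs).le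
    have hcl : closure (Ico 0 s₂) ⊆ {s : ℝ | ‖Φ s‖ ≤ f s} := hZ.closure_subset_iff.2 hsub
    rw [closure_Ico hs₂pos.ne] at hcl
    exact fun s hs => hcl hs
  -- ### the squared physical radius `ρ₂(s) = e^{−2γs}‖Φ s‖²` and its derivative
  set ρ₂ : ℝ → ℝ := fun s => Real.exp (-2 * γ * s) * ‖Φ s‖ ^ 2 with hρ₂def
  set ρ₂' : ℝ → ℝ := fun s => 2 * Real.exp (-2 * γ * s) * ⟪Φ s, V' (Φ s)⟫ with hρ₂'def
  have hρ₂d : ∀ s, HasDerivAt ρ₂ (ρ₂' s) s := by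
    intro s
    have he : HasDerivAt (fun s => Real.exp (-2 * γ * s)) (Real.exp (-2 * γ * s) * (-2 * γ)) s := by
      have := ((hasDerivAt_id s).const_mul (-2 * γ)).exp
      simpa using this
    have hn : HasDerivAt (fun s => ‖Φ s‖ ^ 2) (2 * ⟪Φ s, selfSimilarTransport γ 0 V' (Φ s)⟫) s := (hΦd s).norm_sq
    have h := he.mul hn
    refine h.congr_deriv ?_
    rw [hρ₂'def, selfSimilarTransport_apply, sub_zero, inner_add_right, real_inner_smul_right, real_inner_self_eq_norm_sq]
    ring
  have hρ₂'c : Continuous ρ₂' := by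
    have h1 : Continuous fun s => Real.exp (-2 * γ * s) := by fun_prop
    exact (continuous_const.mul h1).mul (hΦc.inner (hV'.continuous.comp hΦc))
  -- FTC on `[0, s₂]`
  have hFTC : ∫ s in (0 : ℝ)..s₂, ρ₂' s = ρ₂ s₂ - ρ₂ 0 :=
    intervalIntegral.integral_eq_sub_of_hasDerivAt (fun s _ => hρ₂d s) (hρ₂'c.intervalIntegrable _ _)
  -- the climb: `ρ₂ s₂ ≥ (CL)²`, `ρ₂ 0 < (CL)²/4`
  have hρ₂top : (C * L) ^ 2 ≤ ρ₂ s₂ := by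
    have h1 : (C * L * Real.exp (s₂ / (2 + ρ))) ^ 2 ≤ ‖Φ s₂‖ ^ 2 := pow_le_pow_left₀ (by positivity) hexit 2
    have e : Real.exp (-2 * γ * s₂) * (C * L * Real.exp (s₂ / (2 + ρ))) ^ 2 = (C * L) ^ 2 := by
      have hee : Real.exp (-2 * γ * s₂) * Real.exp (s₂ / (2 + ρ)) ^ 2 = 1 := by
        rw [← Real.exp_nat_mul, ← Real.exp_add]
        have : -2 * γ * s₂ + ((2 : ℕ) : ℝ) * (s₂ / (2 + ρ)) = 0 := by
          rw [hγdef]; field_simp; ring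
        rw [this, Real.exp_zero]
      calc Real.exp (-2 * γ * s₂) * (C * L * Real.exp (s₂ / (2 + ρ))) ^ 2
          = (C * L) ^ 2 * (Real.exp (-2 * γ * s₂) * Real.exp (s₂ / (2 + ρ)) ^ 2) := by ring
        _ = (C * L) ^ 2 := by rw [hee, mul_one]
    calc (C * L) ^ 2 = Real.exp (-2 * γ * s₂) * (C * L * Real.exp (s₂ / (2 + ρ))) ^ 2 := e.symm
      _ ≤ Real.exp (-2 * γ * s₂) * ‖Φ s₂‖ ^ 2 := mul_le_mul_of_nonneg_left h1 (Real.exp_pos _).le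
  have hρ₂bot : ρ₂ 0 < (C * L) ^ 2 / 4 := by
    have e : ρ₂ 0 = ‖y‖ ^ 2 := by simp [hρ₂def, hΦ0]
    rw [e]
    have h1 : ‖y‖ ^ 2 < L ^ 2 := by nlinarith [norm_nonneg y]
    have h2 : 2 * L ≤ C * L := by nlinarith
    have h4 : 4 * L ^ 2 ≤ (C * L) ^ 2 := by nlinarith [mul_le_mul h2 h2 (by positivity) (by positivity)]
    linarith
  -- the bound `ρ₂′ ≤ 2CL·e^{−γs}‖V′(Φ s)‖` on `[0, s₂]`
  set g : ℝ → ℝ := fun s => Real.exp (-(γ * s)) * ‖V' (Φ s)‖ with hgdef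
  have hgc : Continuous g := by
    have h1 : Continuous fun s => Real.exp (-(γ * s)) := by fun_prop
    exact h1.mul (hV'.continuous.comp hΦc).norm
  have hρ₂'le : ∀ s ∈ Icc 0 s₂, ρ₂' s ≤ 2 * (C * L) * g s := by
    intro s hs
    have h1 : ⟪Φ s, V' (Φ s)⟫ ≤ ‖Φ s‖ * ‖V' (Φ s)‖ := real_inner_le_norm _ _
    have h2 : ‖Φ s‖ * ‖V' (Φ s)‖ ≤ f s * ‖V' (Φ s)‖ := mul_le_mul_of_nonneg_right (hstay s hs) (norm_nonneg _)
    have he : 0 < Real.exp (-2 * γ * s) := Real.exp_pos _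
    have e : 2 * Real.exp (-2 * γ * s) * (f s * ‖V' (Φ s)‖) = 2 * (C * L) * g s := by
      simp only [hfdef, hgdef]
      have : Real.exp (-2 * γ * s) * Real.exp (s / (2 + ρ)) = Real.exp (-(γ * s)) := by
        rw [← Real.exp_add]; congr 1; rw [hγdef]; field_simp; ring
      calc 2 * Real.exp (-2 * γ * s) * (C * L * Real.exp (s / (2 + ρ)) * ‖V' (Φ s)‖)
          = 2 * (C * L) * ((Real.exp (-2 * γ * s) * Real.exp (s / (2 + ρ))) * ‖V' (Φ s)‖) := by ring
        _ = 2 * (C * L) * (Real.exp (-(γ * s)) * ‖V' (Φ s)‖) := by rw [this]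
    calc ρ₂' s = 2 * Real.exp (-2 * γ * s) * ⟪Φ s, V' (Φ s)⟫ := rfl
      _ ≤ 2 * Real.exp (-2 * γ * s) * (f s * ‖V' (Φ s)‖) := mul_le_mul_of_nonneg_left (h1.trans h2) (by positivity)
      _ = 2 * (C * L) * g s := e
  have hI₁ : 3 / 8 * (C * L) ≤ ∫ s in (0 : ℝ)..s₂, g s := by
    have hmono : ∫ s in (0 : ℝ)..s₂, ρ₂' s ≤ ∫ s in (0 : ℝ)..s₂, 2 * (C * L) * g s :=
      intervalIntegral.integral_mono_on hs₂0 (hρ₂'c.intervalIntegrable _ _) ((continuous_const.mul hgc).intervalIntegrable _ _)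
        fun s hs => hρ₂'le s hs
    rw [intervalIntegral.integral_const_mul, hFTC] at hmono
    nlinarith
  -- ### Cauchy–Schwarz in time, in `ℝ≥0∞`
  have hg0 : ∀ s, 0 ≤ g s := fun s => mul_nonneg (Real.exp_pos _).le (norm_nonneg _)
  have hgint : IntegrableOn g (Ioc 0 s₂) := (hgc.continuousOn.integrableOn_compact isCompact_Icc).mono_set Ioc_subset_Icc_self
  have hI₁' : ENNReal.ofReal (3 / 8 * (C * L)) ≤ ∫⁻ s in Ioc 0 s₂, ENNReal.ofReal (g s) := by
    rw [← ofReal_integral_eq_lintegral_ofReal hgint (ae_of_all _ hg0), ← intervalIntegral.integral_of_le hs₂0]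
    exact ENNReal.ofReal_le_ofReal hI₁
  -- split `g = e^{−s/2} · (e^{(1/2−γ)s}‖V′‖)`
  set a : ℝ → ℝ≥0∞ := fun s => ENNReal.ofReal (Real.exp (-(s / 2))) with hadef
  set b : ℝ → ℝ≥0∞ := fun s => ENNReal.ofReal (Real.exp ((1 / 2 - γ) * s) * ‖V' (Φ s)‖) with hbdef
  have hab : ∀ s, ENNReal.ofReal (g s) = a s * b s := by
    intro s
    rw [hadef, hbdef]
    simp only
    rw [← ENNReal.ofReal_mul (Real.exp_pos _).le]
    congr 1
    simp only [hgdef]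
    rw [← mul_assoc, ← Real.exp_add]
    congr 2; ring
  have ham : AEMeasurable a (volume.restrict (Ioc 0 s₂)) := by
    have : Continuous fun s : ℝ => Real.exp (-(s / 2)) := by fun_prop
    exact this.measurable.ennreal_ofReal.aemeasurable
  have hbm : AEMeasurable b (volume.restrict (Ioc 0 s₂)) := by
    have : Continuous fun s : ℝ => Real.exp ((1 / 2 - γ) * s) * ‖V' (Φ s)‖ :=
      (by fun_prop : Continuous fun s : ℝ => Real.exp ((1 / 2 - γ) * s)).mul (hV'.continuous.comp hΦc).norm
    exact this.measurable.ennreal_ofReal.aemeasurable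
  have hCS := ENNReal.lintegral_mul_le_Lp_mul_Lq (volume.restrict (Ioc 0 s₂)) Real.HolderConjugate.two_two ham hbm
  have e2 : ∀ x : ℝ≥0∞, x ^ (2 : ℝ) = x ^ 2 := fun x => by exact_mod_cast ENNReal.rpow_natCast x 2
  simp only [Pi.mul_apply, e2] at hCS
  -- `∫ a² ≤ 1`
  have ha2 : ∫⁻ s in Ioc 0 s₂, a s ^ 2 ≤ 1 := by
    have e : ∀ s, a s ^ 2 = ENNReal.ofReal (Real.exp (-s)) := fun s => by
      rw [hadef]
      simp only
      rw [← ENNReal.ofReal_pow (Real.exp_pos _).le, ← Real.exp_nat_mul]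
      congr 1; push_cast; ring
    simp_rw [e]
    calc ∫⁻ s in Ioc 0 s₂, ENNReal.ofReal (Real.exp (-s)) ≤ ∫⁻ s in Icc 0 S, ENNReal.ofReal (Real.exp (-s)) :=
          lintegral_mono_set (Ioc_subset_Icc_self.trans (Icc_subset_Icc_right hs₂S))
      _ ≤ 1 := lintegral_exp_neg_Icc_le_one hS
  -- `b² = e^{(1−2γ)s}‖V′‖²`
  have hb2 : ∀ s, b s ^ 2 = ENNReal.ofReal (Real.exp ((1 - 2 * γ) * s)) * ‖V' (Φ s)‖ₑ ^ 2 := by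
    intro s
    rw [hbdef]
    simp only
    rw [ENNReal.ofReal_mul (Real.exp_pos _).le, mul_pow, ← ENNReal.ofReal_pow (Real.exp_pos _).le, ← Real.exp_nat_mul,
      ofReal_norm]
    congr 2; push_cast; ring
  -- combine: `ofReal(3/8 CL) ≤ (∫ b²)^{1/2}`, then square
  have hsq : ENNReal.ofReal (3 / 8 * (C * L)) ≤ (∫⁻ s in Ioc 0 s₂, b s ^ 2) ^ (1 / 2 : ℝ) := by
    have h1 : ∫⁻ s in Ioc 0 s₂, ENNReal.ofReal (g s) = ∫⁻ s in Ioc 0 s₂, a s * b s := lintegral_congr fun s => hab s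
    rw [h1] at hI₁'
    refine hI₁'.trans (hCS.trans ?_)
    calc (∫⁻ s in Ioc 0 s₂, a s ^ 2) ^ (1 / 2 : ℝ) * (∫⁻ s in Ioc 0 s₂, b s ^ 2) ^ (1 / 2 : ℝ)
        ≤ 1 ^ (1 / 2 : ℝ) * (∫⁻ s in Ioc 0 s₂, b s ^ 2) ^ (1 / 2 : ℝ) := by gcongr
      _ = (∫⁻ s in Ioc 0 s₂, b s ^ 2) ^ (1 / 2 : ℝ) := by rw [ENNReal.one_rpow, one_mul]
  have hsq2 : ENNReal.ofReal (9 / 64 * (C * L) ^ 2) ≤ ∫⁻ s in Ioc 0 s₂, b s ^ 2 := by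
    have h := ENNReal.rpow_le_rpow hsq (by norm_num : (0 : ℝ) ≤ 2)
    rw [← ENNReal.rpow_mul, show (1 / 2 : ℝ) * 2 = 1 by norm_num, ENNReal.rpow_one, e2,
      ← ENNReal.ofReal_pow (by positivity)] at h
    have e : (3 / 8 * (C * L)) ^ 2 = 9 / 64 * (C * L) ^ 2 := by ring
    rwa [e] at h
  -- ### into the stay-indicator integral over `[0, S]`
  simp_rw [hb2] at hsq2
  refine hsq2.trans ?_
  calc ∫⁻ s in Ioc 0 s₂, ENNReal.ofReal (Real.exp ((1 - 2 * γ) * s)) * ‖V' (Φ s)‖ₑ ^ 2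
      = ∫⁻ s in Ioc 0 s₂, indicator {σ' : ℝ | ∀ σ'' ∈ Icc 0 σ', ‖Φ σ''‖ ≤ C * L * Real.exp (σ'' / (2 + ρ))}
          (fun σ' : ℝ => ENNReal.ofReal (Real.exp ((1 - 2 * γ) * σ')) * ‖V' (Φ σ')‖ₑ ^ 2) s := by
        refine setLIntegral_congr_fun measurableSet_Ioc (fun s hs => ?_)
        rw [indicator_of_mem]
        exact fun σ'' hσ'' => hstay σ'' ⟨hσ''.1, hσ''.2.trans hs.2⟩
    _ ≤ ∫⁻ s in Icc 0 S, indicator {σ' : ℝ | ∀ σ'' ∈ Icc 0 σ', ‖Φ σ''‖ ≤ C * L * Real.exp (σ'' / (2 + ρ))}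
          (fun σ' : ℝ => ENNReal.ofReal (Real.exp ((1 - 2 * γ) * σ')) * ‖V' (Φ σ')‖ₑ ^ 2) s :=
        lintegral_mono_set (Ioc_subset_Icc_self.trans (Icc_subset_Icc_right hs₂S))

/-! ### THE FORWARD ESCAPE LAW -/

/-- ★ **THE FORWARD ESCAPE LAW (t59-ESC, `NsregP2.R54.Trace.ForwardEscapeLaw ρ V` VERBATIM with `simFlow` unfolded, every `ρ > −2`).**  For a self-similar Euler profile
`(V, P)` with exponent `1/(2+ρ)` and the `A`-gauge, in the cut-off idiom: the labels `y ∈ B_L` whose physical radius `e^{−s/(2+ρ)}‖Ψ_s y‖` reaches `C·L` (`C ≥ 2`) before the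
horizon `S` have volume `≤ 8A(CL)^{−(1+2ρ)}`, uniformly in `S`, `V′`, `K`, `Rbig`.  Per-label crossing inequality (`escape_crossing_bound`), Markov over the labels,
Tonelli, the velocity slice (`lintegral_velocitySq_slice_le`), the exponent identity `(1−2γ) − 3γ + γ(1−2ρ) = −1` and `∫₀^S e^{−σ} ≤ 1`; constant `64/9 ≤ 8`.
[nsreg-p2 R54 §C t59-ESC; cite: ConstantinIgnatovaVicol2026Putative, §3.4.1 eq. (3.21)–(3.22)] -/
theorem forwardEscapeLaw {ρ : ℝ} (hρ : -2 < ρ) (V : EuclideanSpace ℝ (Fin 3) → EuclideanSpace ℝ (Fin 3)) :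
    ∀ P : EuclideanSpace ℝ (Fin 3) → ℝ, IsSelfSimilarEulerProfile (1 / (2 + ρ)) 0 V P →
    ∀ A : ℝ, (∀ R : ℝ, 1 ≤ R → ∫ y in ball (0 : EuclideanSpace ℝ (Fin 3)) R, ‖V y‖ ^ 2 ≤ A * R ^ (1 - 2 * ρ)) →
    ∀ (C L S : ℝ) (V' : EuclideanSpace ℝ (Fin 3) → EuclideanSpace ℝ (Fin 3)) (K Rbig : ℝ), 2 ≤ C → 1 ≤ L → 0 ≤ S → ContDiff ℝ 2 V' →
      (∀ y, ‖fderiv ℝ V' y‖ ≤ K) → 2 * C * L * Real.exp (S / (2 + ρ)) < Rbig →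
      (∀ w ∈ ball (0 : EuclideanSpace ℝ (Fin 3)) Rbig, V' w = V w) →
      (volume {y ∈ ball (0 : EuclideanSpace ℝ (Fin 3)) L |
          ∃ s ∈ Icc 0 S, C * L * Real.exp (s / (2 + ρ)) ≤
            ‖ODE.evolutionMap (fun _ : ℝ => selfSimilarTransport (1 / (2 + ρ)) (0 : EuclideanSpace ℝ (Fin 3)) V') 0 s y‖}).toReal ≤
        8 * A * (C * L) ^ (-(1 + 2 * ρ)) := by
  intro P hprof A hA C L S V' K Rbig hC hL hS hV' hK hRbig hVV'
  have h2ρ : 0 < 2 + ρ := by linarith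
  have hC1 : 1 ≤ C := by linarith
  have hCL : 0 < C * L := by nlinarith
  have hCL0 : 0 ≤ C * L := hCL.le
  set γ : ℝ := 1 / (2 + ρ) with hγ
  obtain ⟨Φ, hΦ⟩ : ∃ Φ : ℝ → EuclideanSpace ℝ (Fin 3) → EuclideanSpace ℝ (Fin 3),
      Φ = ODE.evolutionMap (fun _ : ℝ => selfSimilarTransport γ (0 : EuclideanSpace ℝ (Fin 3)) V') 0 := ⟨_, rfl⟩
  rw [← hΦ]
  -- `A ≥ 0`
  have hA0 : 0 ≤ A := by
    have h := hA 1 le_rfl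
    rw [Real.one_rpow, mul_one] at h
    exact (integral_nonneg fun y => by positivity).trans h
  -- ### the label functional `J` and its measurability
  obtain ⟨T, hT⟩ : ∃ T : Set (EuclideanSpace ℝ (Fin 3) × ℝ),
      T = {p | ∀ σ'' ∈ Icc 0 p.2, ‖Φ σ'' p.1‖ ≤ C * L * Real.exp (σ'' / (2 + ρ))} := ⟨_, rfl⟩
  have hTm : MeasurableSet T := by
    rw [hT, hΦ]
    exact measurableSet_forwardStayProd (γ := γ) hV' hK (f := fun σ'' => C * L * Real.exp (σ'' / (2 + ρ))) (by fun_prop)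
  have hHm : Measurable fun p : EuclideanSpace ℝ (Fin 3) × ℝ =>
      ENNReal.ofReal (Real.exp ((1 - 2 * (1 / (2 + ρ))) * p.2)) * ‖V' (Φ p.2 p.1)‖ₑ ^ 2 := by
    rw [hΦ]
    have h1 : Measurable fun p : EuclideanSpace ℝ (Fin 3) × ℝ => ENNReal.ofReal (Real.exp ((1 - 2 * (1 / (2 + ρ))) * p.2)) :=
      ((by fun_prop : Continuous fun p : EuclideanSpace ℝ (Fin 3) × ℝ => Real.exp ((1 - 2 * (1 / (2 + ρ))) * p.2)).measurable).ennreal_ofReal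
    have h2 : Measurable fun p : EuclideanSpace ℝ (Fin 3) × ℝ =>
        ‖V' (ODE.evolutionMap (fun _ : ℝ => selfSimilarTransport γ (0 : EuclideanSpace ℝ (Fin 3)) V') 0 p.2 p.1)‖ₑ ^ 2 :=
      ((hV'.continuous.comp ((continuous_flow_uncurry (γ := γ) hV' hK).comp (continuous_snd.prodMk continuous_fst))).measurable.enorm).pow_const 2
    exact h1.mul h2
  set F : EuclideanSpace ℝ (Fin 3) → ℝ → ℝ≥0∞ := fun y σ =>
    indicator {σ' : ℝ | ∀ σ'' ∈ Icc 0 σ', ‖Φ σ'' y‖ ≤ C * L * Real.exp (σ'' / (2 + ρ))}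
      (fun σ' : ℝ => ENNReal.ofReal (Real.exp ((1 - 2 * (1 / (2 + ρ))) * σ')) * ‖V' (Φ σ' y)‖ₑ ^ 2) σ with hFdef
  have hunc : Function.uncurry F = T.indicator fun p => ENNReal.ofReal (Real.exp ((1 - 2 * (1 / (2 + ρ))) * p.2)) * ‖V' (Φ p.2 p.1)‖ₑ ^ 2 := by
    funext p
    obtain ⟨y, σ⟩ := p
    rw [hT, Function.uncurry_apply_pair, hFdef]
    simp only
    by_cases h : ∀ σ'' ∈ Icc 0 σ, ‖Φ σ'' y‖ ≤ C * L * Real.exp (σ'' / (2 + ρ))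
    · rw [indicator_of_mem (show σ ∈ {σ' : ℝ | ∀ σ'' ∈ Icc 0 σ', ‖Φ σ'' y‖ ≤ C * L * Real.exp (σ'' / (2 + ρ))} from h),
        indicator_of_mem (show (y, σ) ∈ {p : EuclideanSpace ℝ (Fin 3) × ℝ |
          ∀ σ'' ∈ Icc 0 p.2, ‖Φ σ'' p.1‖ ≤ C * L * Real.exp (σ'' / (2 + ρ))} from h)]
    · rw [indicator_of_notMem (show σ ∉ {σ' : ℝ | ∀ σ'' ∈ Icc 0 σ', ‖Φ σ'' y‖ ≤ C * L * Real.exp (σ'' / (2 + ρ))} from h),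
        indicator_of_notMem (show (y, σ) ∉ {p : EuclideanSpace ℝ (Fin 3) × ℝ |
          ∀ σ'' ∈ Icc 0 p.2, ‖Φ σ'' p.1‖ ≤ C * L * Real.exp (σ'' / (2 + ρ))} from h)]
  have hFm : Measurable (Function.uncurry F) := by rw [hunc]; exact hHm.indicator hTm
  set J : EuclideanSpace ℝ (Fin 3) → ℝ≥0∞ := fun y => ∫⁻ σ in Icc 0 S, F y σ with hJdef
  have hJm : Measurable J := hFm.lintegral_prod_right
  -- ### per label: the crossing inequality
  set c₀ : ℝ≥0∞ := ENNReal.ofReal (9 / 64 * (C * L) ^ 2) with hc₀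
  have hc₀pos : c₀ ≠ 0 := by
    rw [hc₀]; exact (ENNReal.ofReal_pos.2 (by positivity)).ne'
  have hc₀top : c₀ ≠ ⊤ := ENNReal.ofReal_ne_top
  set E : Set (EuclideanSpace ℝ (Fin 3)) := {y ∈ ball (0 : EuclideanSpace ℝ (Fin 3)) L |
      ∃ s ∈ Icc 0 S, C * L * Real.exp (s / (2 + ρ)) ≤ ‖Φ s y‖} with hEdef
  have hlabel : ∀ y ∈ E, c₀ ≤ J y := by
    intro y hy
    rw [hEdef] at hy
    have hyL : ‖y‖ < L := mem_ball_zero_iff.1 hy.1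
    have h := escape_crossing_bound h2ρ.ne' hV' hK hC (by linarith) hS hyL (by rw [hΦ] at hy; exact hy.2)
    rw [← hΦ] at h
    exact h
  -- ### Markov over the labels
  set μ : Measure (EuclideanSpace ℝ (Fin 3)) := volume.restrict (ball (0 : EuclideanSpace ℝ (Fin 3)) L) with hμ
  have hmarkov : c₀ * volume E ≤ ∫⁻ y in ball (0 : EuclideanSpace ℝ (Fin 3)) L, J y := by
    have h1 := mul_meas_ge_le_lintegral₀ (μ := μ) hJm.aemeasurable c₀
    have h2 : volume E ≤ μ {y | c₀ ≤ J y} := by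
      rw [hμ, Measure.restrict_apply (measurableSet_le measurable_const hJm)]
      exact measure_mono fun y hy => ⟨hlabel y hy, by rw [hEdef] at hy; exact hy.1⟩
    exact (mul_le_mul_right h2 c₀).trans h1
  -- ### Tonelli
  have hswap : ∫⁻ y in ball (0 : EuclideanSpace ℝ (Fin 3)) L, J y =
      ∫⁻ σ in Icc 0 S, ∫⁻ y in ball (0 : EuclideanSpace ℝ (Fin 3)) L, F y σ := by
    rw [hJdef]
    exact lintegral_lintegral_swap (hFm.aemeasurable)
  -- ### the slice bound
  have hslice : ∀ σ ∈ Icc (0 : ℝ) S, ∫⁻ y in ball (0 : EuclideanSpace ℝ (Fin 3)) L, F y σ ≤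
      ENNReal.ofReal (A * (C * L) ^ (1 - 2 * ρ)) * ENNReal.ofReal (Real.exp (-σ)) := by
    intro σ hσ
    have hSm : MeasurableSet {y : EuclideanSpace ℝ (Fin 3) | ∀ σ'' ∈ Icc 0 σ, ‖Φ σ'' y‖ ≤ C * L * Real.exp (σ'' / (2 + ρ))} := by
      rw [hΦ]
      exact (isClosed_forwardStay_fun (γ := γ) hV' hK σ (fun σ' => C * L * Real.exp (σ' / (2 + ρ)))).measurableSet
    have e1 : ∀ y : EuclideanSpace ℝ (Fin 3), F y σ =
        indicator {y : EuclideanSpace ℝ (Fin 3) | ∀ σ'' ∈ Icc 0 σ, ‖Φ σ'' y‖ ≤ C * L * Real.exp (σ'' / (2 + ρ))}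
          (fun y => ENNReal.ofReal (Real.exp ((1 - 2 * (1 / (2 + ρ))) * σ)) * ‖V' (Φ σ y)‖ₑ ^ 2) y := by
      intro y
      rw [hFdef]
      simp only
      by_cases h : ∀ σ'' ∈ Icc 0 σ, ‖Φ σ'' y‖ ≤ C * L * Real.exp (σ'' / (2 + ρ))
      · rw [indicator_of_mem (show σ ∈ {σ' : ℝ | ∀ σ'' ∈ Icc 0 σ', ‖Φ σ'' y‖ ≤ C * L * Real.exp (σ'' / (2 + ρ))} from h),
          indicator_of_mem (show y ∈ {y : EuclideanSpace ℝ (Fin 3) |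
            ∀ σ'' ∈ Icc 0 σ, ‖Φ σ'' y‖ ≤ C * L * Real.exp (σ'' / (2 + ρ))} from h)]
      · rw [indicator_of_notMem (show σ ∉ {σ' : ℝ | ∀ σ'' ∈ Icc 0 σ', ‖Φ σ'' y‖ ≤ C * L * Real.exp (σ'' / (2 + ρ))} from h),
          indicator_of_notMem (show y ∉ {y : EuclideanSpace ℝ (Fin 3) |
            ∀ σ'' ∈ Icc 0 σ, ‖Φ σ'' y‖ ≤ C * L * Real.exp (σ'' / (2 + ρ))} from h)]
    simp_rw [e1]
    rw [lintegral_indicator hSm, Measure.restrict_restrict hSm]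
    have eF : {y : EuclideanSpace ℝ (Fin 3) | ∀ σ'' ∈ Icc 0 σ, ‖Φ σ'' y‖ ≤ C * L * Real.exp (σ'' / (2 + ρ))} ∩
        ball (0 : EuclideanSpace ℝ (Fin 3)) L =
        {y ∈ ball (0 : EuclideanSpace ℝ (Fin 3)) L | ∀ σ' ∈ Icc 0 σ, ‖Φ σ' y‖ ≤ C * L * Real.exp (σ' / (2 + ρ))} := by
      ext y; simp only [mem_inter_iff, mem_setOf_eq]; tauto
    rw [eF, lintegral_const_mul' _ _ ENNReal.ofReal_ne_top]
    have h := lintegral_velocitySq_slice_le hρ hprof hA hC1 hL hV' hK hRbig hVV' hσ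
    rw [← hΦ] at h
    calc ENNReal.ofReal (Real.exp ((1 - 2 * (1 / (2 + ρ))) * σ)) *
          ∫⁻ y in {y ∈ ball (0 : EuclideanSpace ℝ (Fin 3)) L | ∀ σ' ∈ Icc 0 σ, ‖Φ σ' y‖ ≤ C * L * Real.exp (σ' / (2 + ρ))},
            ‖V' (Φ σ y)‖ₑ ^ 2
        ≤ ENNReal.ofReal (Real.exp ((1 - 2 * (1 / (2 + ρ))) * σ)) *
            ENNReal.ofReal (Real.exp (-(3 * (1 / (2 + ρ)) * σ)) * (A * (C * L * Real.exp (σ / (2 + ρ))) ^ (1 - 2 * ρ))) :=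
          mul_le_mul_right h _
      _ = ENNReal.ofReal (A * (C * L) ^ (1 - 2 * ρ)) * ENNReal.ofReal (Real.exp (-σ)) := by
          rw [← ENNReal.ofReal_mul (Real.exp_pos _).le, ← ENNReal.ofReal_mul (by positivity)]
          congr 1
          have hb := escape_bookkeeping (C := C) (L := L) (σ := σ) h2ρ hCL0
          calc Real.exp ((1 - 2 * (1 / (2 + ρ))) * σ) *
                (Real.exp (-(3 * (1 / (2 + ρ)) * σ)) * (A * (C * L * Real.exp (σ / (2 + ρ))) ^ (1 - 2 * ρ)))
              = A * (Real.exp ((1 - 2 * (1 / (2 + ρ))) * σ) *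
                  (Real.exp (-(3 * (1 / (2 + ρ)) * σ)) * (C * L * Real.exp (σ / (2 + ρ))) ^ (1 - 2 * ρ))) := by ring
            _ = A * ((C * L) ^ (1 - 2 * ρ) * Real.exp (-σ)) := by rw [hb]
            _ = A * (C * L) ^ (1 - 2 * ρ) * Real.exp (-σ) := by ring
  -- ### the time integral and the assembly
  have htime : ∫⁻ σ in Icc 0 S, ∫⁻ y in ball (0 : EuclideanSpace ℝ (Fin 3)) L, F y σ ≤ ENNReal.ofReal (A * (C * L) ^ (1 - 2 * ρ)) := by
    calc ∫⁻ σ in Icc 0 S, ∫⁻ y in ball (0 : EuclideanSpace ℝ (Fin 3)) L, F y σ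
        ≤ ∫⁻ σ in Icc 0 S, ENNReal.ofReal (A * (C * L) ^ (1 - 2 * ρ)) * ENNReal.ofReal (Real.exp (-σ)) :=
          setLIntegral_mono' measurableSet_Icc hslice
      _ = ENNReal.ofReal (A * (C * L) ^ (1 - 2 * ρ)) * ∫⁻ σ in Icc 0 S, ENNReal.ofReal (Real.exp (-σ)) :=
          lintegral_const_mul _ ((by fun_prop : Continuous fun σ : ℝ => Real.exp (-σ)).measurable.ennreal_ofReal)
      _ ≤ ENNReal.ofReal (A * (C * L) ^ (1 - 2 * ρ)) * 1 := mul_le_mul_right (lintegral_exp_neg_Icc_le_one hS) _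
      _ = ENNReal.ofReal (A * (C * L) ^ (1 - 2 * ρ)) := mul_one _
  have hmain : c₀ * volume E ≤ ENNReal.ofReal (A * (C * L) ^ (1 - 2 * ρ)) := hmarkov.trans (by rw [hswap]; exact htime)
  -- `vol E ≤ ofReal(A (CL)^{1−2ρ}) / c₀`, in real numbers `≤ (64/9) A (CL)^{−(1+2ρ)} ≤ 8 A (CL)^{−(1+2ρ)}`
  have hdiv : volume E ≤ ENNReal.ofReal (A * (C * L) ^ (1 - 2 * ρ)) / c₀ := by
    rw [ENNReal.le_div_iff_mul_le (Or.inl hc₀pos) (Or.inl hc₀top), mul_comm]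
    exact hmain
  have hfin : ENNReal.ofReal (A * (C * L) ^ (1 - 2 * ρ)) / c₀ ≠ ⊤ := ENNReal.div_ne_top ENNReal.ofReal_ne_top hc₀pos
  have hreal := ENNReal.toReal_mono hfin hdiv
  rw [ENNReal.toReal_div, ENNReal.toReal_ofReal (by positivity), hc₀, ENNReal.toReal_ofReal (by positivity)] at hreal
  refine hreal.trans ?_
  -- real bookkeeping
  have e : (C * L) ^ (1 - 2 * ρ) = (C * L) ^ (-(1 + 2 * ρ)) * (C * L) ^ 2 := by
    rw [← Real.rpow_two, ← Real.rpow_add hCL]; congr 1; ring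
  rw [e, div_le_iff₀ (by positivity : (0 : ℝ) < 9 / 64 * (C * L) ^ 2)]
  have hX : 0 ≤ A * (C * L) ^ (-(1 + 2 * ρ)) := mul_nonneg hA0 (Real.rpow_nonneg hCL0 _)
  nlinarith [hX, sq_nonneg (C * L)]

end Summit.NavierStokesRegularity.NavierStokesRegularity.Theorems.PowerGaugeEulerLiouville.Trace

end
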